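import Summits.QuantumFields.QCD.Theorems.QuarksAsStableActionCriticalLineDiamagnetismCellKappaSoundC

/-!
# Cell-pressure certificate of the static route — the certificate
(crux stmt-QuantumFields-9734, line `Sketch`, stub `stub_heavyFrequencyGain`, Route B step B6; lead c3)

The COMPUTATION: the affine-arithmetic checker `cellKappaCheck` of `…CellKappaEval` accepts the heavy box
`M ∈ [5.89, 6.1]`, `|s₀|, |s₁| ≤ 1/10` at scale `S = 2^52`, table half-width `K = 12`, walk length `J = 14`, partner distance
`R = 7`, cover `8 × 1 × 1` (`cellKappaCheck_holds`, `native_decide`, ≈ 5 min; margins ≈ 6·10⁻⁴ > 1/4000 on every slice).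
With the soundness theorem `cellKappaClaim_of_check` (`…CellKappaSoundC`) this proves the certified claim `CellKappaClaim`
of `…CellKappaDefs` (`cellKappaClaim_holds`, registered).  Computational proof (`native_decide`).
-/

namespace Summit.QuantumFields.QCD.Cruxes.CriticalLineDiamagnetism.ChessboardCellGain.CellKappa

/-- **The certificate** (computational): every sub-box of the `8 × 1 × 1` cover passes the checker at scale `2^52`. -/
theorem cellKappaCheck_holds : cellKappaCheck (2 ^ 52) 12 14 7 8 1 = true := by
  native_decide

/-- **The certified claim** (registered helper `cellKappaClaim_holds`): on the heavy box the truncated tadpole beats the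
truncated absolute bubble bound by `1/4000` (`J = 14`, `R = 7`). -/
theorem cellKappaClaim_holds : CellKappaClaim :=
  cellKappaClaim_of_check (2 ^ 52) 12 8 1 (by norm_num) (by norm_num) (by norm_num) (by norm_num) cellKappaCheck_holds

end Summit.QuantumFields.QCD.Cruxes.CriticalLineDiamagnetism.ChessboardCellGain.CellKappa
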